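/-
Origin: expansion seat `planner-pub-hodgecm-pv10-g2-0`, handover #3 2026-08-18T07:14:22Z (`HOME/pub-hodgecm-pv10-g2/lean/Pv10g2/NormOneCompactMathlib.lean`, md5 133bc326, 55 lines);
landed by the gen-7 packager in gate run 25 as `HodgeCM/PerL34/NormOneCompactMathlib.lean` (import ^import Pv[0-9]+g[0-9]+\.→import HodgeCM.PerL34. ×2).
-/
/-
Origin: planner-pub-hodgecm-pv10-g2-0 (unit pub-hodgecm-pv10-g2, DAG-NODE PROVER #10 gen 2), HodgeCM
publication cell, 2026-08-18.  WIP module `Pv10g2.NormOneCompactMathlib`; intended landing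
`HodgeCM/PerL34/NormOneCompactMathlib.lean` (additive leaf; lands after `UnitLatticeShells` and
`IdeleClassNumber` of this seat).
-/
import Summits.HodgeConjecture.HodgeCM.PerL34.UnitLatticeShells
import Summits.HodgeConjecture.HodgeCM.PerL34.IdeleClassNumber

/-!
# `C¹_K` is compact — KERNEL from Mathlib alone (node N15 leaf, cone-free)

Node N15 of the HodgeCM publication DAG: the one print input `NumberField.NormOneIdeleClassesCompact K`
("the norm-one idele class group `C¹_K = 𝔸_K^1 / K^×` is compact", PerL v5 tex l. 311;
Cassels–Fröhlich II §16, Neukirch VI (1.6)) of the character-extension step.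

This file closes that leaf in the kernel WITHOUT any cited fact and WITHOUT the vendored cone
(`HodgeCM/Vendored/**` is not imported, directly or transitively): the classical proof
"finiteness of the class number + Dirichlet's unit theorem ⇒ `C¹_K` compact" assembled from

* `NormOneFromClassNumber.normOneIdeleClassesCompact_of_classNumber_of_shells` (the assembly, r24),
* `IdeleClassNumber.ideleClassNumberFinite_holds` — (CL) from Mathlib's
  `NumberField.RingOfIntegers.instFintypeClassGroup`,
* `UnitLatticeShells.archShellCompactModPrincipal_holds` — (UT) from Mathlib's
  `NumberField.Units.instZLattice_unitLattice` (Dirichlet).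

`normOneIdeleClassesCompact_mathlib K` has the SAME TYPE as the cone-backed
`NumberField.normOneIdeleClassesCompact_holds K` of `HodgeCM/Literature/NormOneCompactHolds.lean`
(referee A ruling G5, vendored Cassels–Fröhlich II §16), so every consumer
(`ProperBaseChange.isProperMap_baseChange`, `ClassNormProper.isProperMap_logClassNorm`,
`Literature/ClassBaseChange*`) can be fed this proof instead; re-pointing is the packager's call.
-/

set_option autoImplicit false

noncomputable section

namespace NumberField

variable (K : Type*) [Field K] [NumberField K]

/-- **`C¹_K` is compact** (KERNEL, Mathlib only, no vendored cone): the norm-one idele classes of a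
number field form a compact subset of the idele class group. -/
theorem normOneIdeleClassesCompact_mathlib : NormOneIdeleClassesCompact K :=
  normOneIdeleClassesCompact_of_classNumber_of_shells K (ideleClassNumberFinite_holds K)
    (archShellCompactModPrincipal_holds K)

/-- The same, unfolded: `IsCompact (C¹_K)`. -/
theorem isCompact_normOneIdeleClasses_mathlib :
    IsCompact (normOneIdeleClasses K : Set (IdeleClassGroup K)) :=
  normOneIdeleClassesCompact_mathlib K

end NumberField

end
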